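import Mathlib.Combinatorics.SimpleGraph.Metric
import Literature.Analysis.FluidPDE.TaoWhitneyCover
import Literature.Probability.RandomPlanarGeometry.ConformalRemovabilityWhitneyCount
import HarnessLib

/-!
# The graph of Whitney discs of a planar domain (support for Jones–Smirnov 2000, Thm. 2–3)

P. W. Jones, S. K. Smirnov, *Removability theorems for Sobolev functions and quasiconformal maps*,
Ark. Mat. 38 (2000) 263–279, §§3–4, work with the Whitney decomposition `W = {Q}` of a domain
`Ω` and the tree structure on it induced by a family of curves (hyperbolic geodesics from a base
point, p. 267: "Γ consists of hyperbolic geodesics, starting at the origin … Sh(Q) — the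
'shadow' — is the union of the landing points of all geodesics … passing through `Q`"), and in
the proof of Thm. 3 (p. 275) with the graph whose vertices are Whitney cubes, two cubes being
joined when they touch, rooted at a central cube, `q(Q) :=` (graph distance to the root) + 1.

This file builds the planar version with Whitney *discs* instead of cubes, which is all the
removability proof needs: for an open set `Ω ⊊ ℂ` we use the radius `r(z) = dist(z, Ωᶜ)/100`
(`1/100`-Lipschitz, `lipschitzWith_infDist_div`), a Whitney family `S` of centres in the sense of
`Literature.Analysis.FluidPDE.IsWhitneyFamily` (disjoint quarter discs, the discs cover `Ω`), and
the graph on `S` in which `x ∼ y` iff the triple discs `B(x, 3r(x))`, `B(y, 3r(y))` meet. We prove: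

* `infDist_le_of_triple_balls`, `dist_lt_of_triple_balls`: adjacent centres have comparable radii
  (`97 r(y) ≤ 103 r(x)`) and distance `< 3 r(x) + 3 r(y)`;
* `finite_triple_balls_meeting`: the graph is locally finite (disc packing,
  `card_mul_le_of_disjoint_balls`);
* `connected_fromRel_of_cover`: the graph is connected when `Ω` is (the discs of a reachability
  class and of its complement form an open partition of `Ω`);
* `exists_adj_dist_eq_dist_add_one`: in a connected graph every non-root vertex has a neighbour one
  step closer to the root (the breadth-first "parent"), and `iterate_parent_eq_root`: iterating such
  a parent map `dist` times reaches the root.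

The quasihyperbolic boundary condition for the graph distance and the packaging of the rooted tree
are in `ConformalRemovabilityQHBC.lean`.
-/

noncomputable section

open Set Metric MeasureTheory Filter

open scoped NNReal ENNReal Topology

namespace Literature.Probability.RandomPlanarGeometry

variable {Ω : Set ℂ}

/-! ### The Whitney radius `dist(z, Ωᶜ) / 100` -/

/-- The Whitney radius `z ↦ dist(z, Ωᶜ)/100` is `1/100`-Lipschitz. [folklore] -/
theorem lipschitzWith_infDist_div (Ω : Set ℂ) :
    LipschitzWith (1 / 100 : ℝ≥0) (fun z : ℂ => infDist z Ωᶜ / 100) := by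
  refine LipschitzWith.of_dist_le_mul fun x y => ?_
  have h1 := infDist_le_infDist_add_dist (s := Ωᶜ) (x := x) (y := y)
  have h2 := infDist_le_infDist_add_dist (s := Ωᶜ) (x := y) (y := x)
  rw [dist_comm y x] at h2
  rw [Real.dist_eq, show infDist x Ωᶜ / 100 - infDist y Ωᶜ / 100 =
      (infDist x Ωᶜ - infDist y Ωᶜ) / 100 by ring, abs_div,
    abs_of_pos (by norm_num : (0 : ℝ) < 100)]
  have h3 : |infDist x Ωᶜ - infDist y Ωᶜ| ≤ dist x y := abs_sub_le_iff.2 ⟨by linarith, by linarith⟩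
  have h4 : ((1 / 100 : ℝ≥0) : ℝ) = 1 / 100 := by norm_num
  rw [h4]
  linarith

/-- The Whitney radius is positive on an open set with nonempty complement. [folklore] -/
theorem infDist_compl_pos (hΩ : IsOpen Ω) (hc : Ωᶜ.Nonempty) {z : ℂ} (hz : z ∈ Ω) :
    0 < infDist z Ωᶜ := by
  rw [← infDist_pos_iff_notMem_closure hc, hΩ.isClosed_compl.closure_eq]
  exact fun h => h hz

/-- If the triple discs `B(x, 3a)` and `B(y, 3b)` meet then `dist(x, y) < 3a + 3b`: the instance of
Mathlib's `dist_lt_add_of_nonempty_ball_inter_ball`; the name is kept as a one-line restatement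
because `ConformalRemovabilityWhitneyTree` and `ConformalRemovabilityHubs` use it (dedup-00806).
[folklore] -/
theorem dist_lt_of_triple_balls {x y : ℂ} {a b : ℝ}
    (h : (ball x (3 * a) ∩ ball y (3 * b)).Nonempty) : dist x y < 3 * a + 3 * b :=
  dist_lt_add_of_nonempty_ball_inter_ball h

/-- **Adjacent Whitney discs have comparable radii**: if the triple discs of `x` and `y` (radius
`r = dist(·, Ωᶜ)/100`) meet, then `97 dist(y, Ωᶜ) ≤ 103 dist(x, Ωᶜ)`. [folklore] -/
theorem infDist_le_of_triple_balls {x y : ℂ}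
    (h : (ball x (3 * (infDist x Ωᶜ / 100)) ∩ ball y (3 * (infDist y Ωᶜ / 100))).Nonempty) :
    97 * infDist y Ωᶜ ≤ 103 * infDist x Ωᶜ := by
  have hd := dist_lt_of_triple_balls h
  have h1 := infDist_le_infDist_add_dist (s := Ωᶜ) (x := y) (y := x)
  rw [dist_comm] at h1
  linarith

/-! ### Local finiteness -/

/-- **The Whitney graph is locally finite**: if the quarter discs `B(y, r(y)/4)`, `y ∈ S ⊆ Ω`, are
pairwise disjoint (`r = dist(·, Ωᶜ)/100`), then for every `x ∈ Ω` only finitely many `y ∈ S` have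
their triple disc meeting the triple disc of `x` (their quarter discs have radius `≥ r(x)/5` and
lie in `B(x, 7 r(x))`: at most `1225` of them). [folklore] -/
theorem finite_triple_balls_meeting (hΩ : IsOpen Ω) (hc : Ωᶜ.Nonempty) {S : Set ℂ}
    (hdisj : S.PairwiseDisjoint fun y => ball y (infDist y Ωᶜ / 100 / 4)) {x : ℂ} (hx : x ∈ Ω) :
    {y ∈ S | (ball x (3 * (infDist x Ωᶜ / 100)) ∩
      ball y (3 * (infDist y Ωᶜ / 100))).Nonempty}.Finite := by
  classical
  by_contra hinf
  have hd := infDist_compl_pos hΩ hc hx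
  obtain ⟨F, hFsub, hFcard⟩ := (Set.not_finite.1 hinf).exists_subset_card_eq 1226
  have hF : ∀ y ∈ F, y ∈ S ∧ (ball x (3 * (infDist x Ωᶜ / 100)) ∩
      ball y (3 * (infDist y Ωᶜ / 100))).Nonempty := fun y hy => hFsub (Finset.mem_coe.2 hy)
  have key := card_mul_le_of_disjoint_balls (F := F) (ρ := fun y => infDist y Ωᶜ / 100 / 4)
    (ρ₀ := infDist x Ωᶜ / 500) (V := Real.pi * (7 * (infDist x Ωᶜ / 100)) ^ 2)
    (T := ball x (7 * (infDist x Ωᶜ / 100))) (by positivity) (by positivity) ?_ ?_ ?_ ?_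
  · rw [hFcard] at key
    have : 0 < Real.pi * infDist x Ωᶜ ^ 2 := by positivity
    nlinarith
  · intro y hy
    have h1 := infDist_le_of_triple_balls (Ω := Ω) (x := y) (y := x)
      (by rw [inter_comm]; exact (hF y hy).2)
    change infDist x Ωᶜ / 500 ≤ infDist y Ωᶜ / 100 / 4
    linarith
  · exact hdisj.subset fun y hy => (hF y (Finset.mem_coe.1 hy)).1
  · intro y hy z hz
    have h1 := infDist_le_of_triple_balls (hF y hy).2
    have h2 := dist_lt_of_triple_balls (hF y hy).2
    rw [mem_ball] at hz ⊢
    calc dist z x ≤ dist z y + dist x y := by rw [dist_comm x y]; exact dist_triangle _ _ _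
      _ < 7 * (infDist x Ωᶜ / 100) := by linarith
  · exact Dyadic.volume_ball_le x (by positivity)

/-! ### Connectivity -/

/-- **The Whitney graph of a connected region is connected.** If `S ⊆ Ω` is nonempty, the discs
`B(x, r(x))`, `x ∈ S`, have positive radii and cover the preconnected set `Ω`, then the graph on
`S` joining `x ≠ y` when `B(x, 3r(x)) ∩ B(y, 3r(y)) ≠ ∅` is connected: the discs of the centres
reachable from `a`, resp. not reachable from `a`, form two open sets covering `Ω`, and a point in
both would lie in two discs whose centres are then adjacent. [folklore] -/
theorem connected_fromRel_of_cover {S : Set ℂ} {r : ℂ → ℝ} (hΩ : IsPreconnected Ω) (hS : S ⊆ Ω)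
    (hr : ∀ x ∈ S, 0 < r x) (hcover : Ω ⊆ ⋃ x ∈ S, ball x (r x)) (hne : S.Nonempty) :
    (SimpleGraph.fromRel fun x y : S =>
      (ball (x : ℂ) (3 * r x) ∩ ball (y : ℂ) (3 * r y)).Nonempty).Connected := by
  classical
  set G := SimpleGraph.fromRel fun x y : S =>
    (ball (x : ℂ) (3 * r x) ∩ ball (y : ℂ) (3 * r y)).Nonempty with hG
  haveI : Nonempty S := hne.to_subtype
  rw [SimpleGraph.connected_iff]
  refine ⟨fun a b => ?_, inferInstance⟩
  by_contra hab
  set U₁ : Set ℂ := ⋃ s : {s : S // G.Reachable a s}, ball ((s : S) : ℂ) (r s) with hU₁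
  set U₂ : Set ℂ := ⋃ s : {s : S // ¬ G.Reachable a s}, ball ((s : S) : ℂ) (r s) with hU₂
  have hU₁o : IsOpen U₁ := isOpen_iUnion fun _ => isOpen_ball
  have hU₂o : IsOpen U₂ := isOpen_iUnion fun _ => isOpen_ball
  have hcov : Ω ⊆ U₁ ∪ U₂ := by
    intro z hz
    obtain ⟨x, hx, hzx⟩ := mem_iUnion₂.1 (hcover hz)
    by_cases h : G.Reachable a ⟨x, hx⟩
    · exact Or.inl (mem_iUnion.2 ⟨⟨⟨x, hx⟩, h⟩, hzx⟩)
    · exact Or.inr (mem_iUnion.2 ⟨⟨⟨x, hx⟩, h⟩, hzx⟩)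
  have h1 : (Ω ∩ U₁).Nonempty :=
    ⟨a, hS a.2, mem_iUnion.2 ⟨⟨a, SimpleGraph.Reachable.refl _⟩, mem_ball_self (hr a a.2)⟩⟩
  have h2 : (Ω ∩ U₂).Nonempty :=
    ⟨b, hS b.2, mem_iUnion.2 ⟨⟨b, hab⟩, mem_ball_self (hr b b.2)⟩⟩
  obtain ⟨z, -, hz1, hz2⟩ := hΩ U₁ U₂ hU₁o hU₂o hcov h1 h2
  obtain ⟨⟨s, hs⟩, hzs⟩ := mem_iUnion.1 hz1
  obtain ⟨⟨t, ht⟩, hzt⟩ := mem_iUnion.1 hz2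
  refine ht (hs.trans ?_)
  by_cases hst : s = t
  · rw [hst]
  · refine SimpleGraph.Adj.reachable ?_
    rw [hG, SimpleGraph.fromRel_adj]
    refine ⟨hst, Or.inl ⟨z, ?_, ?_⟩⟩
    · exact ball_subset_ball (by linarith [hr s s.2]) hzs
    · exact ball_subset_ball (by linarith [hr t t.2]) hzt

/-! ### Breadth-first parents -/

/-- In a connected graph every vertex `v ≠ u` has a neighbour `w` one step closer to `u`:
`dist(u, v) = dist(u, w) + 1` (the second vertex of a shortest walk from `v` to `u`). [folklore] -/
theorem exists_adj_dist_eq_dist_add_one {V : Type*} {G : SimpleGraph V} (hconn : G.Connected)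
    {u v : V} (hv : v ≠ u) : ∃ w, G.Adj v w ∧ G.dist u v = G.dist u w + 1 := by
  obtain ⟨p, hp⟩ := hconn.exists_walk_length_eq_dist v u
  cases p with
  | nil => exact absurd rfl hv
  | cons h q =>
    rename_i w
    refine ⟨w, h, ?_⟩
    rw [SimpleGraph.Walk.length_cons] at hp
    have h1 : G.dist u w ≤ q.length := by rw [SimpleGraph.dist_comm]; exact SimpleGraph.dist_le q
    have h2 : G.dist u v ≤ G.dist u w + G.dist w v := h.symm.reachable.dist_triangle_right u
    have h3 : G.dist w v = 1 := SimpleGraph.dist_eq_one_iff_adj.2 h.symm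
    have h4 : G.dist u v = q.length + 1 := by rw [SimpleGraph.dist_comm]; exact hp.symm
    omega

/-- If `parent` moves every vertex `v ≠ u` one step closer to `u`, then iterating it `dist(u, v)`
times from `v` reaches `u`. [folklore] -/
theorem iterate_parent_eq_root {V : Type*} {G : SimpleGraph V} (hconn : G.Connected) {u : V}
    {parent : V → V} (hpar : ∀ v, v ≠ u → G.dist u v = G.dist u (parent v) + 1) :
    ∀ v, parent^[G.dist u v] v = u := by
  suffices h : ∀ n, ∀ v, G.dist u v = n → parent^[n] v = u from fun v => h _ v rfl
  intro n
  induction n with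
  | zero =>
    intro v hv
    rw [hconn.dist_eq_zero_iff] at hv
    simp [hv]
  | succ n ih =>
    intro v hv
    have hv0 : v ≠ u := by
      rintro rfl
      simp at hv
    rw [Function.iterate_succ_apply]
    apply ih
    have := hpar v hv0
    omega

end Literature.Probability.RandomPlanarGeometry
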